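import Summits.ResolutionOfSingularities.ResolutionOfSingularities.Theorems.LossEntryW10
import HarnessLib

/-!
# LossEntryW11 — walk plumbing of the loss→entry law `LawLossEntry`, part 11/11

decomp-res-lens-3, gen 29 (HOME/decomp-res-lens-3/g29/NODE-g29.md).  TOOL at 0 toward the residual item
stmt-ResolutionOfSingularities-27367 (`WallCut.NoLossyStrictTailsDeep` ⟸ `LossEpisode.LawLossEntry`).  Imports part 10 (`Theorems.LossEntryW10`, to be landed first).

Contents: §16 `lawLossEntryAt_of_loss_stays` (all four `Stays` presentations), residual `LawLossChainAt`/`LawLossChain`, `lawLossEntry_of_lawLossChain`, `noLossyStrictTailsDeep_of_lawLossChain`; §17 `exists_stays_after_loss`, skeletons `lawLossChainAt_of_steps`, `lawLossEntryAt_of_wallSteps`.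
-/

open MvPolynomial Finset
open Literature.AlgebraicGeometry.Resolution
open Literature.AlgebraicGeometry.Resolution.Hauser2010
open Literature.AlgebraicGeometry.Resolution.PointBlowup
open Summit.ResolutionOfSingularities.ResolutionOfSingularities.Theorems.TightDefectClasses
open Summit.ResolutionOfSingularities.ResolutionOfSingularities.Theorems.TightDefectStrongWalks
open Summit.ResolutionOfSingularities.ResolutionOfSingularities.Theorems.ItineraryCutClasses
open Summit.ResolutionOfSingularities.ResolutionOfSingularities.Theorems.BoundaryLedger
open Summit.ResolutionOfSingularities.ResolutionOfSingularities.Theorems.ProximityCut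
open Summit.ResolutionOfSingularities.ResolutionOfSingularities.Theorems.LossIsFatalLayer (chartMap chartMap_X chartMap_X_self
  chartMap_X_ne chartMap_C)
open Summit.ResolutionOfSingularities.ResolutionOfSingularities.Theorems.LossExitCone
open Summit.ResolutionOfSingularities.ResolutionOfSingularities.Theorems.LossPolygon

/-! ## §16 All four `Stays` presentations combined; the entry law modulo the residual CHAIN law -/

namespace Summit.ResolutionOfSingularities.ResolutionOfSingularities.Theorems.LossEpisode

open Summit.ResolutionOfSingularities.ResolutionOfSingularities.Theorems.LossPolygon

variable {K : Type} [Field K] [DecidableEq K] {q : ℕ} {s₀ : State (Fin 3) K}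

section Stays

variable {W : ForcedWalk q s₀} {N s : ℕ}

/-- **LAW (L_E) FOR AN IMMEDIATE REPEAT (PROVED, all presentations):** a total loss at a heavy run state on the tail that is
followed by a proximity repeat (`StaysOnNewest`) lands two moves later in a heavy run state of strictly smaller `β`.
Case split on `runState_next`: the three two-wall arrows contradict the loss; the loss arrows (a) [`j_t = i`; repeat in the
chart `j` (`lawLossEntryAt_of_loss_a1`) or `l` (`lawLossEntryAt_of_loss_a2`)], (b) [`lawLossEntryAt_of_loss_b`] and
(c) [`lawLossEntryAt_of_loss_c`]. [new] -/
theorem lawLossEntryAt_of_loss_stays (hroot : IsRoot q s₀) (hT : TailHyp W N s)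
    (hLucas : ∀ D T : ℕ, q ∣ D → ¬ q ∣ T → ((D.choose T : ℕ) : K) = 0) {t : ℕ} (hNt : N ≤ t) {i j l : Fin 3}
    {k m : ℕ} (hS : IsRunState W s t i j l k m) (hm : q ≤ m + s) (hloss : IsLossMove W t) (hst : StaysOnNewest W t) :
    ∃ u : ℕ, t < u ∧ ∃ (i' j' l' : Fin 3) (k' m' : ℕ), IsRunState W s u i' j' l' k' m' ∧ q ≤ m' + s ∧
      runBeta W s u i' j' l' < runBeta W s t i j l := by
  obtain ⟨-, -, -, hnext⟩ := runState_next hroot hT hNt hS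
  have h1k : 1 ≤ k := hS.2.2.2.1
  have h1m : 1 ≤ m := hS.2.2.2.2.1
  rcases hnext with ⟨hjt, -, hS'⟩ | ⟨hjt, -, hS'⟩ | ⟨hjt, -, -, hS'⟩ | ⟨htyp, -, -⟩
  · exfalso
    obtain ⟨-, hrj', -⟩ := hS'.r_apply
    have h0 := hloss j (by rw [hjt]; exact fun h => hS.1 h.symm)
    omega
  · exfalso
    obtain ⟨hri', -, -⟩ := hS'.r_apply
    have h0 := hloss i (by rw [hjt]; exact hS.1)
    omega
  · exfalso
    obtain ⟨hri', -, -⟩ := hS'.r_apply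
    have h0 := hloss i (by rw [hjt]; exact fun h => hS.2.1 h.symm)
    omega
  · rcases htyp with ⟨hjt, hbj⟩ | ⟨hjt, hbi⟩ | ⟨hjt, hbi, hbj⟩
    · have hj1 : W.j (t + 1) ≠ i := by rw [← hjt]; exact hst.1
      rcases fin3_eq_or i j l (W.j (t + 1)) hS.1 (Ne.symm hS.2.1) (Ne.symm hS.2.2.1) with h | h | h
      · exact absurd h hj1
      · exact lawLossEntryAt_of_loss_a1 hroot hT hLucas hNt hS hm hjt hbj hloss hst h
      · exact lawLossEntryAt_of_loss_a2 hroot hT hLucas hNt hS hm hjt hbj hloss hst h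
    · exact lawLossEntryAt_of_loss_b hroot hT hNt hS hm hjt hbi hloss hst
    · exact lawLossEntryAt_of_loss_c hroot hT hLucas hNt hS hm hjt hbi hbj hloss hst

/-- **THE RESIDUAL CHAIN LAW at one tail.** A total loss at a heavy run state on the tail that is followed by FURTHER loss
moves (`¬ StaysOnNewest`: the chain of one-wall states `T₁ > T₂ > ⋯`, `T_{ν+1} = T_ν + s − q`, ended by the first repeat)
still leads to a heavy run state of strictly smaller `β`.  This is exactly what `LawLossEntryAt` still needs beyond
`lawLossEntryAt_of_loss_stays` (see `lawLossEntryAt_of_lawLossChainAt`). [new] -/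
def LawLossChainAt (W : ForcedWalk q s₀) (N s : ℕ) : Prop :=
  ∀ t : ℕ, N ≤ t → ∀ (i j l : Fin 3) (k m : ℕ), IsRunState W s t i j l k m → q ≤ m + s → IsLossMove W t →
    ¬ StaysOnNewest W t →
    ∃ u : ℕ, t < u ∧ ∃ (i' j' l' : Fin 3) (k' m' : ℕ), IsRunState W s u i' j' l' k' m' ∧ q ≤ m' + s ∧
      runBeta W s u i' j' l' < runBeta W s t i j l

/-- `LawLossEntryAt` from the chain law (the `Stays` half is `lawLossEntryAt_of_loss_stays`). [new] -/
theorem lawLossEntryAt_of_lawLossChainAt (hroot : IsRoot q s₀) (hT : TailHyp W N s)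
    (hLucas : ∀ D T : ℕ, q ∣ D → ¬ q ∣ T → ((D.choose T : ℕ) : K) = 0) (hchain : LawLossChainAt W N s) :
    LawLossEntryAt W N s := by
  intro t hNt i j l k m hS hm hloss
  by_cases hst : StaysOnNewest W t
  · exact lawLossEntryAt_of_loss_stays hroot hT hLucas hNt hS hm hloss hst
  · exact hchain t hNt i j l k m hS hm hloss hst

end Stays

/-- **THE RESIDUAL CHAIN LAW, closed form** (quantified VERBATIM like `LawLossEntry`). [new] -/
def LawLossChain : Prop :=
  ∀ p : ℕ, p.Prime → ∀ e : ℕ, 2 ≤ e → ∀ (K : Type) [Field K] [CharP K p] [PerfectField K] [DecidableEq K]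
    (s₀ : State (Fin 3) K), IsRoot (p ^ e) s₀ → ∀ W : ForcedWalk (p ^ e) s₀, ∀ N s : ℕ, TailHyp W N s →
    (∀ M : ℕ, ∃ t, M ≤ t ∧ W.b t ≠ 0) → (∀ (k : Fin 3) (N' : ℕ), ∃ t, N' ≤ t ∧ (W.j t = k ∨ W.b t k ≠ 0)) →
    (∀ M : ℕ, ∃ t, M ≤ t ∧ IsLossMove W t) → LawLossChainAt W N s

/-- **`LawLossEntry` ⟸ `LawLossChain` (PROVED):** the entry law reduces to its chain half (`q = p^e`: Lucas applies). [new] -/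
theorem lawLossEntry_of_lawLossChain (h : LawLossChain) : LawLossEntry := by
  intro p hp e he K _ _ _ _ s₀ hroot W N s hT hb hcoord hlossy
  haveI : Fact p.Prime := ⟨hp⟩
  exact lawLossEntryAt_of_lawLossChainAt hroot hT (fun D T hD hT' => cast_choose_eq_zero_of_pow_dvd p hD hT')
    (h p hp e he K s₀ hroot W N s hT hb hcoord hlossy)

/-- Hence the residual item: `NoLossyStrictTailsDeep` ⟸ `LawLossChain`. [new] -/
theorem noLossyStrictTailsDeep_of_lawLossChain (h : LawLossChain) : WallCut.NoLossyStrictTailsDeep :=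
  noLossyStrictTailsDeep_of_lawLossEntry (lawLossEntry_of_lawLossChain h)

end Summit.ResolutionOfSingularities.ResolutionOfSingularities.Theorems.LossEpisode

/-! ## §17 The chain skeleton: termination of loss chains and the induction that reduces `LawLossChainAt` to three local steps -/

namespace Summit.ResolutionOfSingularities.ResolutionOfSingularities.Theorems.LossEpisode

open Summit.ResolutionOfSingularities.ResolutionOfSingularities.Theorems.LossPolygon

variable {K : Type} [Field K] [DecidableEq K] {q : ℕ} {s₀ : State (Fin 3) K}

section ChainSkeleton

variable {W : ForcedWalk q s₀} {N s : ℕ}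

/-- **LOSS CHAINS TERMINATE (PROVED):** a loss move at `v ≥ N` on the tail starts a finite run of loss moves
`v, v+1, …, w` (`¬ StaysOnNewest` at `v, …, w − 1`) ended by a loss move at `w` that IS followed by a proximity repeat
(`StaysOnNewest W w`) — the wall masses drop by `q − s ≥ 1` at every further loss (`lossMove_next`). [new] -/
theorem exists_stays_after_loss (hroot : IsRoot q s₀) (hT : TailHyp W N s) {v : ℕ} (hNv : N ≤ v) (hloss : IsLossMove W v) :
    ∃ w : ℕ, v ≤ w ∧ IsLossMove W w ∧ StaysOnNewest W w ∧
      ∀ x : ℕ, v ≤ x → x < w → IsLossMove W x ∧ ¬ StaysOnNewest W x := by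
  have hsq : s < q := hT.s_lt
  obtain ⟨T, hoT, -, -, -, -⟩ := lossMove_next hroot hT hNv hloss
  suffices h : ∀ n : ℕ, ∀ v : ℕ, N ≤ v → IsLossMove W v → ∀ T : ℕ, ordZero (W.st v).F = ((q + T : ℕ) : ℕ∞) → T ≤ n →
      ∃ w : ℕ, v ≤ w ∧ IsLossMove W w ∧ StaysOnNewest W w ∧
        ∀ x : ℕ, v ≤ x → x < w → IsLossMove W x ∧ ¬ StaysOnNewest W x from
    h T v hNv hloss T hoT le_rfl
  intro n
  induction n with
  | zero =>
    intro v hNv hloss T hoT hTn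
    obtain ⟨T', hoT', h1T', -⟩ := lossMove_next hroot hT hNv hloss
    exfalso
    rw [hoT] at hoT'
    have : q + T = q + T' := by exact_mod_cast hoT'
    omega
  | succ n ih =>
    intro v hNv hloss T hoT hTn
    obtain ⟨T', hoT', -, -, -, hnext⟩ := lossMove_next hroot hT hNv hloss
    rw [hoT] at hoT'
    have hTT' : T = T' := by
      have : q + T = q + T' := by exact_mod_cast hoT'
      omega
    rcases hnext with ⟨hnst, hloss1, hr2⟩ | ⟨hst, -⟩
    · obtain ⟨T₂, hoT₂, -, hr2', -, -⟩ := lossMove_next hroot hT (by omega : N ≤ v + 1) hloss1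
      have hT₂ : T₂ = T' + s - q := by
        have h : Finsupp.single (W.j (v + 1)) T₂ = Finsupp.single (W.j (v + 1)) (T' + s - q) := hr2'.symm.trans hr2
        exact Finsupp.single_injective _ h
      obtain ⟨w, hvw, hlw, hsw, hrun⟩ := ih (v + 1) (by omega) hloss1 T₂ hoT₂ (by omega)
      refine ⟨w, by omega, hlw, hsw, fun x hvx hxw => ?_⟩
      by_cases hx : x = v
      · subst hx; exact ⟨hloss, hnst⟩
      · exact hrun x (by omega) hxw
    · exact ⟨v, le_rfl, hloss, hst, fun x hvx hxw => absurd hxw (by omega)⟩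

/-- **THE CHAIN SKELETON (PROVED):** `LawLossChainAt` follows from three LOCAL steps about a one-wall-state predicate `P v`
and a potential `B v : ℚ` (to be instantiated by the wall states of the chain and their virtual-repeat `β`, NODE-g29 §ARCH):
(h1) the first loss with `¬ Stays`: `P (t+1)` and `B (t+1) < β_t` (T8b); (h2) a further loss: `P` propagates and `B` does not
increase; (h3) the final repeat from a `P`-state lands in a heavy run state with `β ≤ B`.  Termination is
`exists_stays_after_loss`. [new] -/
theorem lawLossChainAt_of_steps (hroot : IsRoot q s₀) (hT : TailHyp W N s) (P : ℕ → Prop) (B : ℕ → ℚ)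
    (h1 : ∀ t : ℕ, N ≤ t → ∀ (i j l : Fin 3) (k m : ℕ), IsRunState W s t i j l k m → q ≤ m + s → IsLossMove W t →
      ¬ StaysOnNewest W t → P (t + 1) ∧ B (t + 1) < runBeta W s t i j l)
    (h2 : ∀ v : ℕ, N < v → P v → IsLossMove W v → ¬ StaysOnNewest W v → P (v + 1) ∧ B (v + 1) ≤ B v)
    (h3 : ∀ v : ℕ, N < v → P v → IsLossMove W v → StaysOnNewest W v →
      ∃ (i' j' l' : Fin 3) (k' m' : ℕ), IsRunState W s (v + 2) i' j' l' k' m' ∧ q ≤ m' + s ∧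
        runBeta W s (v + 2) i' j' l' ≤ B v) :
    LawLossChainAt W N s := by
  intro t hNt i j l k m hS hm hloss hnst
  obtain ⟨hP1, hB1⟩ := h1 t hNt i j l k m hS hm hloss hnst
  obtain ⟨T, -, -, -, -, hnext⟩ := lossMove_next hroot hT hNt hloss
  rcases hnext with ⟨-, hloss1, -⟩ | ⟨hst, -⟩
  swap
  · exact absurd hst hnst
  obtain ⟨w, htw, hlw, hsw, hrun⟩ := exists_stays_after_loss hroot hT (by omega : N ≤ t + 1) hloss1
  -- `P` and `B` along the chain `t+1, …, w`
  have key : ∀ d : ℕ, t + 1 + d ≤ w → P (t + 1 + d) ∧ B (t + 1 + d) ≤ B (t + 1) := by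
    intro d
    induction d with
    | zero => intro _; exact ⟨hP1, le_rfl⟩
    | succ d ih =>
      intro hd
      obtain ⟨hP, hB⟩ := ih (by omega)
      obtain ⟨hlx, hnx⟩ := hrun (t + 1 + d) (by omega) (by omega)
      obtain ⟨hP', hB'⟩ := h2 (t + 1 + d) (by omega) hP hlx hnx
      rw [show t + 1 + (d + 1) = t + 1 + d + 1 by omega]
      exact ⟨hP', hB'.trans hB⟩
  obtain ⟨hPw, hBw⟩ := key (w - (t + 1)) (by omega)
  rw [show t + 1 + (w - (t + 1)) = w by omega] at hPw hBw
  obtain ⟨i', j', l', k', m', hS', hm', hβ⟩ := h3 w (by omega) hPw hlw hsw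
  exact ⟨w + 2, by omega, i', j', l', k', m', hS', hm', lt_of_le_of_lt (hβ.trans hBw) hB1⟩

/-- **THE WALL-STEP SKELETON (PROVED; the form to instantiate):** the WHOLE of `LawLossEntryAt` from three local steps about
a one-wall-state predicate `P v` and a potential `B v : ℚ` — (h1) the loss at a heavy run state `t` yields `P (t+1)` with
`B (t+1) < β_t` (pencil + T8b: slices 2–4 prove exactly this inside the four `Stays` laws); (h2) a loss move from a `P`-state
yields a `P`-state and does not increase `B` (the CHAIN STEP, open); (h3) a proximity repeat from a `P`-state lands in the run
state handed over by `lossMove_next` with `β ≤ B` (the virtual-repeat identity: slices 2–4 prove it for the first wall state).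
Termination of the loss chain is `exists_stays_after_loss`. [new] -/
theorem lawLossEntryAt_of_wallSteps (hroot : IsRoot q s₀) (hT : TailHyp W N s) (P : ℕ → Prop) (B : ℕ → ℚ)
    (h1 : ∀ t : ℕ, N ≤ t → ∀ (i j l : Fin 3) (k m : ℕ), IsRunState W s t i j l k m → q ≤ m + s → IsLossMove W t →
      P (t + 1) ∧ B (t + 1) < runBeta W s t i j l)
    (h2 : ∀ v : ℕ, N < v → P v → IsLossMove W v → P (v + 1) ∧ B (v + 1) ≤ B v)
    (h3 : ∀ v : ℕ, N ≤ v → IsLossMove W v → StaysOnNewest W v → P (v + 1) → ∀ (l' : Fin 3) (d T : ℕ),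
      IsRunState W s (v + 2) (W.j (v + 1)) (W.j v) l' d T → runBeta W s (v + 2) (W.j (v + 1)) (W.j v) l' ≤ B (v + 1)) :
    LawLossEntryAt W N s := by
  intro t hNt i j l k m hS hm hloss
  obtain ⟨hP1, hB1⟩ := h1 t hNt i j l k m hS hm hloss
  obtain ⟨w, htw, hlw, hsw, hrun⟩ := exists_stays_after_loss hroot hT hNt hloss
  -- `P` and `B` along the chain of wall states `t+1, …, w+1`
  have key : ∀ d : ℕ, t + d ≤ w → P (t + d + 1) ∧ B (t + d + 1) ≤ B (t + 1) := by
    intro d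
    induction d with
    | zero => intro _; exact ⟨hP1, le_rfl⟩
    | succ d ih =>
      intro hd
      obtain ⟨hP, hB⟩ := ih (by omega)
      have hlx : IsLossMove W (t + d + 1) := by
        by_cases hx : t + d + 1 = w
        · rw [hx]; exact hlw
        · exact (hrun (t + d + 1) (by omega) (by omega)).1
      obtain ⟨hP', hB'⟩ := h2 (t + d + 1) (by omega) hP hlx
      rw [show t + (d + 1) + 1 = t + d + 1 + 1 by omega]
      exact ⟨hP', hB'.trans hB⟩
  obtain ⟨hPw, hBw⟩ := key (w - t) (by omega)
  rw [show t + (w - t) + 1 = w + 1 by omega] at hPw hBw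
  -- the run state two moves after the last loss
  obtain ⟨T, -, -, -, hqT, hnext⟩ := lossMove_next hroot hT (by omega : N ≤ w) hlw
  rcases hnext with ⟨hnst, -, -⟩ | ⟨-, l', d, -, -, hTd, h1d, hS'⟩
  · exact absurd hsw hnst
  have hβ := h3 w (by omega) hlw hsw hPw l' d T hS'
  exact ⟨w + 2, by omega, _, _, _, _, _, hS', hqT.le, lt_of_le_of_lt (hβ.trans hBw) hB1⟩

end ChainSkeleton

end Summit.ResolutionOfSingularities.ResolutionOfSingularities.Theorems.LossEpisode
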